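import Literature.Analysis.Calculus.IteratedDerivCompGeometric
import HarnessLib

/-!
# S6-VERTEX: the scaled Taylor vertex `V_β(φ) := β·R((√β)⁻¹φ)` of BLUEPRINT-ECE₁ — EVERY derivative carries the factor `(√β)⁻¹` (`= O(√(γε∕λ))`):
# `|V_β| ≤ M‖φ‖³∕√β`, `‖DV_β‖ ≤ M‖φ‖²∕√β`, `‖D²V_β‖ ≤ M‖φ‖∕√β`, `‖DᵏV_β‖ ≤ M_k∕√β` (`k ≥ 3`, `β ≥ 1`), from a cubic remainder `R` (vanishing 2-jet, `‖D³R‖ ≤ M`)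

Cell `ym3-torus` (YM ladder rung R3 = continuum `SU(2)` Yang–Mills on the three-torus — a RUNG, NOT d = 4, NOT infinite volume, NOT a mass gap, NOT Clay).
Width seat `ym3-torus-px20` (gen 16); `--supports stmt-QuantumFields-20520 --as helper`, count-neutral, definition-free, default heartbeats; registry v11.4 №36
untouched.  BLUEPRINT-ECE₁ S6 («VERTEX SIZE»): after the S2-GAUSS scaling `x = (√β)⁻¹φ` (✓`…LoopLedgerGaussianScaling.integral_mul_exp_neg_mul_action_mul_exp_eq`) the
non-Gaussian part of the one-step weight is `exp(−V_β(φ))` with `V_β(φ) = β·R((√β)⁻¹ • φ)`, `R` the Taylor remainder of the action beyond its Hessian at the minimiser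
(`R(0) = 0`, `DR(0) = 0`, `D²R(0) = 0`).  GBND ∕ (GB-an) (✓`AnchorGap.ActBound.abs_gaussExpect_foldl_dop_prod_le`, any derivative table) and the KP smallness of S6 need
the derivative TABLE of the atom factors; this file supplies the raw table of the vertex, generic over a real normed space `F`:
* §1 `contDiff_vertex`, ★`norm_iteratedFDeriv_vertex_le` — the exact scaling `‖Dᵏ V_β(φ)‖ ≤ β·(√β)^{−k}·‖DᵏR((√β)⁻¹φ)‖` (lit ✓`Literature.Analysis.Calculus.norm_iteratedFDeriv_comp_smul_le`
  BY NAME + Mathlib `iteratedFDeriv_const_smul_apply`); `norm_inv_sqrt_smul(_le)`, the power bookkeeping `mul_inv_sqrt_pow_add_two` & co.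
* §2 the table from HOMOGENEOUS jet bounds on the ball `‖ψ‖ ≤ r` (`|R| ≤ M‖ψ‖³`, `‖D¹R‖ ≤ M‖ψ‖²`, `‖D²R‖ ≤ M‖ψ‖`, `‖DᵏR‖ ≤ M_k`): on `‖φ‖ ≤ r·√β`,
  ★`abs_vertex_le` (`≤ M·(√β)⁻¹·‖φ‖³`), ★`norm_iteratedFDeriv_one_vertex_le` (`≤ M·(√β)⁻¹·‖φ‖²`), ★`norm_iteratedFDeriv_two_vertex_le` (`≤ M·(√β)⁻¹·‖φ‖`),
  ★`norm_iteratedFDeriv_vertex_le_of_three_le` (`≤ M_k·(√β)⁻¹`, `β ≥ 1`).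
* §3 the homogeneous bounds FROM A `C³` BOUND at a vanishing 2-jet (mean-value inequality on balls, Mathlib `Convex.norm_image_sub_le_of_norm_fderiv_le` +
  `norm_fderiv_iteratedFDeriv`): ★`norm_iteratedFDeriv_two_le_of_jet`, ★`norm_iteratedFDeriv_one_le_of_jet`, ★`abs_le_of_jet`.
* §4 ★★`vertex_table_of_jet` — everything assembled: `ContDiff ℝ N R` (`3 ≤ N`), `R 0 = 0`, `D¹R(0) = 0`, `D²R(0) = 0`, `‖D³R‖ ≤ M` on `‖ψ‖ ≤ r`, `1 ≤ β`, `‖φ‖ ≤ P ≤ r√β` ⟹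
  `|V_β φ| ≤ M·P³∕√β`, `‖D¹V_β φ‖ ≤ M·P²∕√β`, `‖D²V_β φ‖ ≤ M·P∕√β`, `‖D³V_β φ‖ ≤ M∕√β` — the S6 sentence «every vertex leg costs `(√β)⁻¹ = O(g_J∕√λ)` on the small-field support
  `‖φ‖ ≤ P = p(g_J)`».

HONEST SCOPE.  [folklore] the chain rule for a dilation and the mean-value inequality; nothing of the chart, of which `R` is the remainder (EXW∘∕GAP♯∘), of the cut (S3), of
GREP∕GBND's assembly, of the datum-locality gap (S7), of Bałaban's expansions, of GAS∕GAS₁∕REP∕H4ᶜ∕S2β or of `FluctuationComparisonRegPrIntL` (stmt-QuantumFields-20520) is proved;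
no summit statement is proved by a helper; rung R3 = SU(2) YM₃ on T³ — NOT d = 4, NOT infinite volume, NOT a mass gap, NOT Clay; the Yang–Mills mass gap is NOT proved.

References: T. Bałaban, CMP **102** (1985) 255–275 [Balaban1985UV3] ((45)–(47), the `O(g_k)` vertices of the small-field expansion); D. C. Brydges, *A short course on cluster
expansions*, Les Houches 1984 [Brydges1986] §3; G. Benfatto, A. Giuliani, V. Mastropietro, AHP **7** (2006) [BenfattoGiulianiMastropietro2006] (dilated jets).
-/

set_option autoImplicit false

noncomputable section

open Set Metric

namespace Summit.QuantumFields.YangMills.Theorems.LoopLedgerVertexScaling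

open Literature.Analysis.Calculus

variable {F : Type*} [NormedAddCommGroup F] [NormedSpace ℝ F]

/-! ## §1 The exact scaling of the vertex and its derivatives -/

/-- the scaled vertex is as smooth as the remainder. [folklore] -/
theorem contDiff_vertex {R : F → ℝ} {N : WithTop ℕ∞} (hR : ContDiff ℝ N R) (β : ℝ) :
    ContDiff ℝ N (fun φ : F => β * R ((Real.sqrt β)⁻¹ • φ)) :=
  contDiff_const.mul (hR.comp (contDiff_const.smul contDiff_id))

/-- `‖(√β)⁻¹ • φ‖ = (√β)⁻¹·‖φ‖`. [folklore] -/
theorem norm_inv_sqrt_smul (β : ℝ) (φ : F) : ‖(Real.sqrt β)⁻¹ • φ‖ = (Real.sqrt β)⁻¹ * ‖φ‖ := by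
  rw [norm_smul, Real.norm_eq_abs, abs_of_nonneg (inv_nonneg.2 (Real.sqrt_nonneg β))]

/-- the scaled point is in the remainder's ball: `‖φ‖ ≤ r·√β ⇒ ‖(√β)⁻¹φ‖ ≤ r` (`β > 0`). [folklore] -/
theorem norm_inv_sqrt_smul_le {β r : ℝ} (hβ : 0 < β) {φ : F} (hφ : ‖φ‖ ≤ r * Real.sqrt β) : ‖(Real.sqrt β)⁻¹ • φ‖ ≤ r := by
  rw [norm_inv_sqrt_smul]
  have hs : 0 < Real.sqrt β := Real.sqrt_pos.2 hβ
  calc (Real.sqrt β)⁻¹ * ‖φ‖ ≤ (Real.sqrt β)⁻¹ * (r * Real.sqrt β) := mul_le_mul_of_nonneg_left hφ (inv_nonneg.2 hs.le)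
    _ = r := by field_simp

/-- ★ **the exact scaling**: `‖Dᵏ V_β(φ)‖ ≤ β·(√β)^{−k}·‖DᵏR((√β)⁻¹φ)‖` for `V_β(φ) = β·R((√β)⁻¹φ)`, `β ≥ 0`, `k ≤ N` (the lit dilation lemma
✓`norm_iteratedFDeriv_comp_smul_le` BY NAME after pulling the constant `β` out). [folklore] -/
theorem norm_iteratedFDeriv_vertex_le {R : F → ℝ} {N : WithTop ℕ∞} (hR : ContDiff ℝ N R) {β : ℝ} (hβ : 0 ≤ β) (φ : F) {k : ℕ}
    (hk : (k : WithTop ℕ∞) ≤ N) :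
    ‖iteratedFDeriv ℝ k (fun φ : F => β * R ((Real.sqrt β)⁻¹ • φ)) φ‖
      ≤ β * (Real.sqrt β)⁻¹ ^ k * ‖iteratedFDeriv ℝ k R ((Real.sqrt β)⁻¹ • φ)‖ := by
  have hg : ContDiff ℝ N (fun φ : F => R ((Real.sqrt β)⁻¹ • φ)) := hR.comp (contDiff_const.smul contDiff_id)
  have h1 : (fun φ : F => β * R ((Real.sqrt β)⁻¹ • φ)) = β • (fun φ : F => R ((Real.sqrt β)⁻¹ • φ)) := by
    funext φ
    simp only [Pi.smul_apply, smul_eq_mul]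
  rw [h1, iteratedFDeriv_const_smul_apply ((hg.of_le hk).contDiffAt), norm_smul, Real.norm_eq_abs, abs_of_nonneg hβ, mul_assoc]
  refine mul_le_mul_of_nonneg_left ?_ hβ
  have h2 := norm_iteratedFDeriv_comp_smul_le hR (Real.sqrt β)⁻¹ φ hk
  rwa [abs_of_nonneg (inv_nonneg.2 (Real.sqrt_nonneg β))] at h2

/-- power bookkeeping: `β·(√β)^{−(k+2)} = (√β)^{−k}` (`β > 0`). [folklore] -/
theorem mul_inv_sqrt_pow_add_two {β : ℝ} (hβ : 0 < β) (k : ℕ) :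
    β * (Real.sqrt β)⁻¹ ^ (k + 2) = (Real.sqrt β)⁻¹ ^ k := by
  have hs : Real.sqrt β ≠ 0 := (Real.sqrt_pos.2 hβ).ne'
  have hss : Real.sqrt β * Real.sqrt β = β := Real.mul_self_sqrt hβ.le
  calc β * (Real.sqrt β)⁻¹ ^ (k + 2)
        = (Real.sqrt β * Real.sqrt β) * ((Real.sqrt β)⁻¹ ^ k * (Real.sqrt β)⁻¹ ^ 2) := by rw [hss, pow_add]
    _ = (Real.sqrt β * (Real.sqrt β)⁻¹) * (Real.sqrt β * (Real.sqrt β)⁻¹) * (Real.sqrt β)⁻¹ ^ k := by ring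
    _ = (Real.sqrt β)⁻¹ ^ k := by rw [mul_inv_cancel₀ hs, one_mul, one_mul]

/-- power bookkeeping, order `0`: `β·((√β)⁻¹·a)³ = (√β)⁻¹·a³` (`β > 0`). [folklore] -/
theorem mul_inv_sqrt_mul_pow_three {β : ℝ} (hβ : 0 < β) (a : ℝ) :
    β * ((Real.sqrt β)⁻¹ * a) ^ 3 = (Real.sqrt β)⁻¹ * a ^ 3 := by
  calc β * ((Real.sqrt β)⁻¹ * a) ^ 3 = β * (Real.sqrt β)⁻¹ ^ (1 + 2) * a ^ 3 := by ring
    _ = (Real.sqrt β)⁻¹ * a ^ 3 := by rw [mul_inv_sqrt_pow_add_two hβ 1, pow_one]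

/-- power bookkeeping, order `1`: `β·(√β)⁻¹·((√β)⁻¹·a)² = (√β)⁻¹·a²`. [folklore] -/
theorem mul_inv_sqrt_mul_pow_two {β : ℝ} (hβ : 0 < β) (a : ℝ) :
    β * (Real.sqrt β)⁻¹ ^ 1 * ((Real.sqrt β)⁻¹ * a) ^ 2 = (Real.sqrt β)⁻¹ * a ^ 2 := by
  calc β * (Real.sqrt β)⁻¹ ^ 1 * ((Real.sqrt β)⁻¹ * a) ^ 2 = β * (Real.sqrt β)⁻¹ ^ (1 + 2) * a ^ 2 := by ring
    _ = (Real.sqrt β)⁻¹ * a ^ 2 := by rw [mul_inv_sqrt_pow_add_two hβ 1, pow_one]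

/-- power bookkeeping, order `2`: `β·(√β)⁻²·((√β)⁻¹·a) = (√β)⁻¹·a`. [folklore] -/
theorem mul_inv_sqrt_pow_two_mul {β : ℝ} (hβ : 0 < β) (a : ℝ) :
    β * (Real.sqrt β)⁻¹ ^ 2 * ((Real.sqrt β)⁻¹ * a) = (Real.sqrt β)⁻¹ * a := by
  calc β * (Real.sqrt β)⁻¹ ^ 2 * ((Real.sqrt β)⁻¹ * a) = β * (Real.sqrt β)⁻¹ ^ (1 + 2) * a := by ring
    _ = (Real.sqrt β)⁻¹ * a := by rw [mul_inv_sqrt_pow_add_two hβ 1, pow_one]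

/-- power bookkeeping, order `k ≥ 3`: `β·(√β)^{−k} ≤ (√β)⁻¹` when `β ≥ 1`. [folklore] -/
theorem mul_inv_sqrt_pow_le_of_three_le {β : ℝ} (hβ : 1 ≤ β) {k : ℕ} (hk : 3 ≤ k) :
    β * (Real.sqrt β)⁻¹ ^ k ≤ (Real.sqrt β)⁻¹ := by
  have hβ0 : 0 < β := lt_of_lt_of_le one_pos hβ
  have hs1 : 1 ≤ Real.sqrt β := by rw [← Real.sqrt_one]; exact Real.sqrt_le_sqrt hβ
  have hs : 0 < Real.sqrt β := lt_of_lt_of_le one_pos hs1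
  obtain ⟨j, rfl⟩ := Nat.exists_eq_add_of_le hk
  have h3 : 3 + j = (j + 1) + 2 := by ring
  rw [h3, mul_inv_sqrt_pow_add_two hβ0 (j + 1), pow_succ']
  refine mul_le_of_le_one_right (inv_nonneg.2 hs.le) ?_
  rw [inv_pow]
  exact inv_le_one_of_one_le₀ (one_le_pow₀ hs1)

/-! ## §2 The table from homogeneous jet bounds -/

/-- ★ order `0`: `|V_β(φ)| ≤ M·(√β)⁻¹·‖φ‖³` on `‖φ‖ ≤ r√β`, from `|R ψ| ≤ M‖ψ‖³` on `‖ψ‖ ≤ r`. [folklore] -/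
theorem abs_vertex_le {R : F → ℝ} {M r β : ℝ} (h0 : ∀ ψ : F, ‖ψ‖ ≤ r → |R ψ| ≤ M * ‖ψ‖ ^ 3) (hβ : 0 < β)
    (φ : F) (hφ : ‖φ‖ ≤ r * Real.sqrt β) :
    |β * R ((Real.sqrt β)⁻¹ • φ)| ≤ M * (Real.sqrt β)⁻¹ * ‖φ‖ ^ 3 := by
  rw [abs_mul, abs_of_pos hβ]
  calc β * |R ((Real.sqrt β)⁻¹ • φ)| ≤ β * (M * ‖(Real.sqrt β)⁻¹ • φ‖ ^ 3) :=
        mul_le_mul_of_nonneg_left (h0 _ (norm_inv_sqrt_smul_le hβ hφ)) hβ.le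
    _ = M * (β * ((Real.sqrt β)⁻¹ * ‖φ‖) ^ 3) := by rw [norm_inv_sqrt_smul]; ring
    _ = M * (Real.sqrt β)⁻¹ * ‖φ‖ ^ 3 := by rw [mul_inv_sqrt_mul_pow_three hβ, mul_assoc]

/-- ★ order `1`: `‖D¹V_β(φ)‖ ≤ M·(√β)⁻¹·‖φ‖²` on `‖φ‖ ≤ r√β`, from `‖D¹R ψ‖ ≤ M‖ψ‖²` on `‖ψ‖ ≤ r`. [folklore] -/
theorem norm_iteratedFDeriv_one_vertex_le {R : F → ℝ} {N : WithTop ℕ∞} (hR : ContDiff ℝ N R) (h1N : (1 : WithTop ℕ∞) ≤ N) {M r β : ℝ}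
    (h1 : ∀ ψ : F, ‖ψ‖ ≤ r → ‖iteratedFDeriv ℝ 1 R ψ‖ ≤ M * ‖ψ‖ ^ 2) (hβ : 0 < β) (φ : F) (hφ : ‖φ‖ ≤ r * Real.sqrt β) :
    ‖iteratedFDeriv ℝ 1 (fun φ : F => β * R ((Real.sqrt β)⁻¹ • φ)) φ‖ ≤ M * (Real.sqrt β)⁻¹ * ‖φ‖ ^ 2 := by
  refine (norm_iteratedFDeriv_vertex_le hR hβ.le φ (by exact_mod_cast h1N)).trans ?_
  calc β * (Real.sqrt β)⁻¹ ^ 1 * ‖iteratedFDeriv ℝ 1 R ((Real.sqrt β)⁻¹ • φ)‖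
        ≤ β * (Real.sqrt β)⁻¹ ^ 1 * (M * ‖(Real.sqrt β)⁻¹ • φ‖ ^ 2) :=
        mul_le_mul_of_nonneg_left (h1 _ (norm_inv_sqrt_smul_le hβ hφ)) (by positivity)
    _ = M * (β * (Real.sqrt β)⁻¹ ^ 1 * ((Real.sqrt β)⁻¹ * ‖φ‖) ^ 2) := by rw [norm_inv_sqrt_smul]; ring
    _ = M * (Real.sqrt β)⁻¹ * ‖φ‖ ^ 2 := by rw [mul_inv_sqrt_mul_pow_two hβ, mul_assoc]

/-- ★ order `2`: `‖D²V_β(φ)‖ ≤ M·(√β)⁻¹·‖φ‖` on `‖φ‖ ≤ r√β`, from `‖D²R ψ‖ ≤ M‖ψ‖` on `‖ψ‖ ≤ r`. [folklore] -/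
theorem norm_iteratedFDeriv_two_vertex_le {R : F → ℝ} {N : WithTop ℕ∞} (hR : ContDiff ℝ N R) (h2N : (2 : WithTop ℕ∞) ≤ N) {M r β : ℝ}
    (h2 : ∀ ψ : F, ‖ψ‖ ≤ r → ‖iteratedFDeriv ℝ 2 R ψ‖ ≤ M * ‖ψ‖) (hβ : 0 < β) (φ : F) (hφ : ‖φ‖ ≤ r * Real.sqrt β) :
    ‖iteratedFDeriv ℝ 2 (fun φ : F => β * R ((Real.sqrt β)⁻¹ • φ)) φ‖ ≤ M * (Real.sqrt β)⁻¹ * ‖φ‖ := by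
  refine (norm_iteratedFDeriv_vertex_le hR hβ.le φ (by exact_mod_cast h2N)).trans ?_
  calc β * (Real.sqrt β)⁻¹ ^ 2 * ‖iteratedFDeriv ℝ 2 R ((Real.sqrt β)⁻¹ • φ)‖
        ≤ β * (Real.sqrt β)⁻¹ ^ 2 * (M * ‖(Real.sqrt β)⁻¹ • φ‖) :=
        mul_le_mul_of_nonneg_left (h2 _ (norm_inv_sqrt_smul_le hβ hφ)) (by positivity)
    _ = M * (β * (Real.sqrt β)⁻¹ ^ 2 * ((Real.sqrt β)⁻¹ * ‖φ‖)) := by rw [norm_inv_sqrt_smul]; ring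
    _ = M * (Real.sqrt β)⁻¹ * ‖φ‖ := by rw [mul_inv_sqrt_pow_two_mul hβ, mul_assoc]

/-- ★ orders `k ≥ 3`: `‖DᵏV_β(φ)‖ ≤ M_k·(√β)⁻¹` on `‖φ‖ ≤ r√β` (`β ≥ 1`), from `‖DᵏR ψ‖ ≤ M_k` on `‖ψ‖ ≤ r`. [folklore] -/
theorem norm_iteratedFDeriv_vertex_le_of_three_le {R : F → ℝ} {N : WithTop ℕ∞} (hR : ContDiff ℝ N R) {k : ℕ} (hk : 3 ≤ k)
    (hkN : (k : WithTop ℕ∞) ≤ N) {Mk r β : ℝ} (hMk : ∀ ψ : F, ‖ψ‖ ≤ r → ‖iteratedFDeriv ℝ k R ψ‖ ≤ Mk) (hβ : 1 ≤ β) (φ : F)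
    (hφ : ‖φ‖ ≤ r * Real.sqrt β) :
    ‖iteratedFDeriv ℝ k (fun φ : F => β * R ((Real.sqrt β)⁻¹ • φ)) φ‖ ≤ Mk * (Real.sqrt β)⁻¹ := by
  have hβ0 : 0 < β := lt_of_lt_of_le one_pos hβ
  have hM0 : 0 ≤ Mk := (norm_nonneg _).trans (hMk _ (norm_inv_sqrt_smul_le hβ0 hφ))
  refine (norm_iteratedFDeriv_vertex_le hR hβ0.le φ hkN).trans ?_
  calc β * (Real.sqrt β)⁻¹ ^ k * ‖iteratedFDeriv ℝ k R ((Real.sqrt β)⁻¹ • φ)‖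
        ≤ β * (Real.sqrt β)⁻¹ ^ k * Mk := mul_le_mul_of_nonneg_left (hMk _ (norm_inv_sqrt_smul_le hβ0 hφ)) (by positivity)
    _ ≤ (Real.sqrt β)⁻¹ * Mk := mul_le_mul_of_nonneg_right (mul_inv_sqrt_pow_le_of_three_le hβ hk) hM0
    _ = Mk * (Real.sqrt β)⁻¹ := mul_comm _ _

/-! ## §3 The homogeneous bounds from a `C³` bound at a vanishing 2-jet -/

/-- ★ `D²R(0) = 0`, `‖D³R‖ ≤ M` on the ball `‖ψ‖ ≤ r` ⟹ `‖D²R ψ‖ ≤ M‖ψ‖` there (mean-value inequality for `D²R`, whose derivative has the norm of `D³R`).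
[folklore] -/
theorem norm_iteratedFDeriv_two_le_of_jet {R : F → ℝ} {N : WithTop ℕ∞} (hR : ContDiff ℝ N R) (h3N : (3 : WithTop ℕ∞) ≤ N) {M r : ℝ}
    (h2 : iteratedFDeriv ℝ 2 R 0 = 0) (hM : ∀ ψ : F, ‖ψ‖ ≤ r → ‖iteratedFDeriv ℝ 3 R ψ‖ ≤ M) (ψ : F) (hψ : ‖ψ‖ ≤ r) :
    ‖iteratedFDeriv ℝ 2 R ψ‖ ≤ M * ‖ψ‖ := by
  have hR3 : ContDiff ℝ 3 R := hR.of_le h3N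
  have hdiff : ∀ x ∈ closedBall (0 : F) r, DifferentiableAt ℝ (iteratedFDeriv ℝ 2 R) x :=
    fun x _ => (hR3.differentiable_iteratedFDeriv (by norm_cast)) x
  have hbound : ∀ x ∈ closedBall (0 : F) r, ‖fderiv ℝ (iteratedFDeriv ℝ 2 R) x‖ ≤ M := fun x hx => by
    rw [norm_fderiv_iteratedFDeriv]
    exact hM x (mem_closedBall_zero_iff.1 hx)
  have h := (convex_closedBall (0 : F) r).norm_image_sub_le_of_norm_fderiv_le hdiff hbound
    (mem_closedBall_self ((norm_nonneg ψ).trans hψ)) (mem_closedBall_zero_iff.2 hψ)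
  rwa [h2, sub_zero, sub_zero] at h

/-- ★ `D¹R(0) = 0`, `D²R(0) = 0`, `‖D³R‖ ≤ M` on `‖ψ‖ ≤ r` ⟹ `‖D¹R ψ‖ ≤ M‖ψ‖²` there (mean value on the smaller ball `‖x‖ ≤ ‖ψ‖`, where `‖D²R‖ ≤ M‖ψ‖`). [folklore] -/
theorem norm_iteratedFDeriv_one_le_of_jet {R : F → ℝ} {N : WithTop ℕ∞} (hR : ContDiff ℝ N R) (h3N : (3 : WithTop ℕ∞) ≤ N) {M r : ℝ}
    (h1 : iteratedFDeriv ℝ 1 R 0 = 0) (h2 : iteratedFDeriv ℝ 2 R 0 = 0) (hM : ∀ ψ : F, ‖ψ‖ ≤ r → ‖iteratedFDeriv ℝ 3 R ψ‖ ≤ M)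
    (ψ : F) (hψ : ‖ψ‖ ≤ r) :
    ‖iteratedFDeriv ℝ 1 R ψ‖ ≤ M * ‖ψ‖ ^ 2 := by
  have hR3 : ContDiff ℝ 3 R := hR.of_le h3N
  have hdiff : ∀ x ∈ closedBall (0 : F) ‖ψ‖, DifferentiableAt ℝ (iteratedFDeriv ℝ 1 R) x :=
    fun x _ => (hR3.differentiable_iteratedFDeriv (by norm_cast)) x
  have hbound : ∀ x ∈ closedBall (0 : F) ‖ψ‖, ‖fderiv ℝ (iteratedFDeriv ℝ 1 R) x‖ ≤ M * ‖ψ‖ := fun x hx => by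
    rw [norm_fderiv_iteratedFDeriv]
    have hx' : ‖x‖ ≤ ‖ψ‖ := mem_closedBall_zero_iff.1 hx
    have hM0 : 0 ≤ M := (norm_nonneg _).trans (hM x (hx'.trans hψ))
    exact (norm_iteratedFDeriv_two_le_of_jet hR h3N h2 hM x (hx'.trans hψ)).trans (mul_le_mul_of_nonneg_left hx' hM0)
  have h := (convex_closedBall (0 : F) ‖ψ‖).norm_image_sub_le_of_norm_fderiv_le hdiff hbound
    (mem_closedBall_self (norm_nonneg ψ)) (mem_closedBall_zero_iff.2 le_rfl)
  rw [h1, sub_zero, sub_zero] at h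
  calc ‖iteratedFDeriv ℝ 1 R ψ‖ ≤ M * ‖ψ‖ * ‖ψ‖ := h
    _ = M * ‖ψ‖ ^ 2 := by ring

/-- ★ `R(0) = 0` and the vanishing 2-jet with `‖D³R‖ ≤ M` on `‖ψ‖ ≤ r` ⟹ `|R ψ| ≤ M‖ψ‖³` there. [folklore] -/
theorem abs_le_of_jet {R : F → ℝ} {N : WithTop ℕ∞} (hR : ContDiff ℝ N R) (h3N : (3 : WithTop ℕ∞) ≤ N) {M r : ℝ}
    (h0 : R 0 = 0) (h1 : iteratedFDeriv ℝ 1 R 0 = 0) (h2 : iteratedFDeriv ℝ 2 R 0 = 0)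
    (hM : ∀ ψ : F, ‖ψ‖ ≤ r → ‖iteratedFDeriv ℝ 3 R ψ‖ ≤ M) (ψ : F) (hψ : ‖ψ‖ ≤ r) :
    |R ψ| ≤ M * ‖ψ‖ ^ 3 := by
  have hR3 : ContDiff ℝ 3 R := hR.of_le h3N
  have hdiff : ∀ x ∈ closedBall (0 : F) ‖ψ‖, DifferentiableAt ℝ R x :=
    fun x _ => (hR3.differentiable (by norm_cast)) x
  have hbound : ∀ x ∈ closedBall (0 : F) ‖ψ‖, ‖fderiv ℝ R x‖ ≤ M * ‖ψ‖ ^ 2 := fun x hx => by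
    rw [← norm_iteratedFDeriv_one]
    have hx' : ‖x‖ ≤ ‖ψ‖ := mem_closedBall_zero_iff.1 hx
    have hM0 : 0 ≤ M := (norm_nonneg _).trans (hM x (hx'.trans hψ))
    refine (norm_iteratedFDeriv_one_le_of_jet hR h3N h1 h2 hM x (hx'.trans hψ)).trans ?_
    exact mul_le_mul_of_nonneg_left (pow_le_pow_left₀ (norm_nonneg x) hx' 2) hM0
  have h := (convex_closedBall (0 : F) ‖ψ‖).norm_image_sub_le_of_norm_fderiv_le hdiff hbound
    (mem_closedBall_self (norm_nonneg ψ)) (mem_closedBall_zero_iff.2 le_rfl)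
  rw [h0, sub_zero, sub_zero, Real.norm_eq_abs] at h
  calc |R ψ| ≤ M * ‖ψ‖ ^ 2 * ‖ψ‖ := h
    _ = M * ‖ψ‖ ^ 3 := by ring

/-! ## §4 The vertex table from the jet data -/

/-- ★★ **THE VERTEX TABLE (BLUEPRINT-ECE₁ S6, «every vertex leg costs `(√β)⁻¹`»).**  Let `R` be `Cᴺ` (`N ≥ 3`) with `R(0) = 0`, `D¹R(0) = 0`, `D²R(0) = 0` and
`‖D³R ψ‖ ≤ M` on the ball `‖ψ‖ ≤ r`; let `β ≥ 1` and `V_β(φ) := β·R((√β)⁻¹φ)`.  Then on the scaled ball `‖φ‖ ≤ P`, `P ≤ r√β` (the small-field support, `P = p(g)`):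
`|V_β φ| ≤ M·(√β)⁻¹·P³`, `‖D¹V_β φ‖ ≤ M·(√β)⁻¹·P²`, `‖D²V_β φ‖ ≤ M·(√β)⁻¹·P`, `‖D³V_β φ‖ ≤ M·(√β)⁻¹`. [folklore] -/
theorem vertex_table_of_jet {R : F → ℝ} {N : WithTop ℕ∞} (hR : ContDiff ℝ N R) (h3N : (3 : WithTop ℕ∞) ≤ N) {M r β P : ℝ}
    (h0 : R 0 = 0) (h1 : iteratedFDeriv ℝ 1 R 0 = 0) (h2 : iteratedFDeriv ℝ 2 R 0 = 0)
    (hM : ∀ ψ : F, ‖ψ‖ ≤ r → ‖iteratedFDeriv ℝ 3 R ψ‖ ≤ M) (hβ : 1 ≤ β) (hPr : P ≤ r * Real.sqrt β)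
    (φ : F) (hφ : ‖φ‖ ≤ P) :
    |β * R ((Real.sqrt β)⁻¹ • φ)| ≤ M * (Real.sqrt β)⁻¹ * P ^ 3 ∧
    ‖iteratedFDeriv ℝ 1 (fun φ : F => β * R ((Real.sqrt β)⁻¹ • φ)) φ‖ ≤ M * (Real.sqrt β)⁻¹ * P ^ 2 ∧
    ‖iteratedFDeriv ℝ 2 (fun φ : F => β * R ((Real.sqrt β)⁻¹ • φ)) φ‖ ≤ M * (Real.sqrt β)⁻¹ * P ∧
    ‖iteratedFDeriv ℝ 3 (fun φ : F => β * R ((Real.sqrt β)⁻¹ • φ)) φ‖ ≤ M * (Real.sqrt β)⁻¹ := by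
  have hβ0 : 0 < β := lt_of_lt_of_le one_pos hβ
  have hφ' : ‖φ‖ ≤ r * Real.sqrt β := hφ.trans hPr
  have hM0 : 0 ≤ M := (norm_nonneg _).trans (hM _ (norm_inv_sqrt_smul_le hβ0 hφ'))
  have hc : 0 ≤ M * (Real.sqrt β)⁻¹ := mul_nonneg hM0 (inv_nonneg.2 (Real.sqrt_nonneg β))
  have h1N : (1 : WithTop ℕ∞) ≤ N := le_trans (by exact_mod_cast (by norm_num : (1 : ℕ) ≤ 3)) h3N
  have h2N : (2 : WithTop ℕ∞) ≤ N := le_trans (by exact_mod_cast (by norm_num : (2 : ℕ) ≤ 3)) h3N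
  refine ⟨?_, ?_, ?_, ?_⟩
  · refine (abs_vertex_le (fun ψ hψ => abs_le_of_jet hR h3N h0 h1 h2 hM ψ hψ) hβ0 φ hφ').trans ?_
    exact mul_le_mul_of_nonneg_left (pow_le_pow_left₀ (norm_nonneg φ) hφ 3) hc
  · refine (norm_iteratedFDeriv_one_vertex_le hR h1N (fun ψ hψ => norm_iteratedFDeriv_one_le_of_jet hR h3N h1 h2 hM ψ hψ) hβ0 φ hφ').trans ?_
    exact mul_le_mul_of_nonneg_left (pow_le_pow_left₀ (norm_nonneg φ) hφ 2) hc
  · refine (norm_iteratedFDeriv_two_vertex_le hR h2N (fun ψ hψ => norm_iteratedFDeriv_two_le_of_jet hR h3N h2 hM ψ hψ) hβ0 φ hφ').trans ?_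
    exact mul_le_mul_of_nonneg_left hφ hc
  · exact norm_iteratedFDeriv_vertex_le_of_three_le hR le_rfl h3N hM hβ φ hφ'

end Summit.QuantumFields.YangMills.Theorems.LoopLedgerVertexScaling

end
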